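import Summits.BirchSwinnertonDyer.Rank1Residual.X1.UnrSeriesFirstUnitCoeff
import Summits.BirchSwinnertonDyer.Rank1Residual.X11b.Three.UnrSeriesTwist
import Mathlib.NumberTheory.Padics.RingHoms
import Mathlib.Algebra.CharP.Lemmas
import Mathlib.Algebra.CharP.Algebra
import HarnessLib

/-!
# ROAD B12 ∕ B12′ — the Σ-EULER-FACTOR lemma, PART 1: `(1+T)^b mod p` (Frobenius) and the DEGREE-ONE factor
# `1 − u·(1+T)^b ∈ R₀⟦T⟧`: `μ = 0`, first unit coefficient at `0` or at `p^{v_p(b)}` (every prime `p`;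
# THEOREMS ONLY, Theses-free)

Cell `bsd-stepL` (run/shared/lean/pub/bsd-stepL/), seat `bsd-stepL-bdp` (prover g25, 2026-08-27). `--supports
stmt-BirchSwinnertonDyer-19702 --as helper`. Memo: HOME/proof/PROOF-BDP.md §58.3 (Σ-factors), §60.4 (the λ of a
local factor, settled on paper), §61 (this file and PART 2 `ErratumRoadFiveSigmaEulerFactorFirstUnitCoeff.lean`).

WHAT THIS IS FOR. The partner-transfer hypothesis TRANSFER|ᵍ of
`ErratumRoadFiveIMCDivClassicalBGuardedInvFromThm124bTransfer.lean` (p558697, l.158) ∕ TRANSFER₃ of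
`ClassRecordThreeIMCDivTwoLociAtThreeRFromThm57Transfer.lean` (p554219) asks its supplier to EXHIBIT the two
Σ-imprimitivity factors `P, P′ ∈ R₀⟦T⟧` with indices `m, m′` and the conjuncts
`FU(P, m) := ‖[T^m]P‖ = 1 ∧ ∀ i < m, ‖[T^i]P‖ < 1` (`μ(P) = 0`, `λ(P) = m`; Washington Prop. 7.2), `FU(P′, m′)`.
The true factors are products over the primes `𝔩 ∣ ℓ ∣ N` (all split in the Heegner field, finitely decomposed in
the anticyclotomic tower) of `Q_𝔩(γ_𝔩)`, `γ_𝔩 = γ^{b_𝔩} ↔ (1+T)^{b_𝔩}` with `b_𝔩 ∈ ℤ_p ∖ {0}` (`p^{v_p(b_𝔩)}` =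
number of primes of `K_∞` over `𝔩`) and `Q_𝔩 ∈ ℤ_p[Y]`, `Q_𝔩(0) = 1`: for `E` at `ℓ ∥ N`, `Q = 1 − a_ℓ ℓ⁻¹ Y`; for a
rational partner good at `ℓ`, `Q = 1 − a′_ℓ ℓ⁻¹ Y + ℓ⁻¹ Y²` ([GreenbergVatsal2000, Prop. 2.4]; anticyclotomic: C.-H. Kim,
AJM 21 (2017) Def. 4.6 ∕ Thm. 4.7; [Castella2018, (3.1)]). `(1+T)^b ∈ R₀⟦T⟧` is the tree's
`(PowerSeries.binomialSeries ℤ_[p] b).map (Halves.toUnr p)` (`X11b/Three/UnrSeriesTwist.lean`). PART 1 PROVES: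

* §1 `norm_lt_one_iff_toZMod_eq_zero`, `norm_eq_one_iff_toZMod_ne_zero` (norm currency of `ℤ_p` vs. reduction
  mod `p`), `norm_toUnr` (`ℤ_p → R₀` isometric), `norm_coeff_map_toUnr`.
* §2 `binomialSeries_natCast_mul`: `(1+T)^{n·r} = ((1+T)^r)^n`.
* §3 **`exists_map_toZMod_binomialSeries_eq`**: for `b = p^s·b′`, `(1+T)^b ≡ 1 + T^{p^s}·H (mod p)` with
  `H(0) = b̄′^{p^s}` (Frobenius in `𝔽_p⟦T⟧`); hence `C(b, i) ≡ 0 (mod p)` for `0 < i < p^s`, `C(b, p^s) ≡ b̄′^{p^s}`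
  (`toZMod_choose_eq_zero_of_lt`, `toZMod_choose_pow`), and in `R₀⟦T⟧` the coefficients of `(1+T)^b` of index
  `0 < i < p^s` are non-units, the one at `p^s` a unit when `b′ ∈ ℤ_p^×` (`norm_coeff_binomialSeries_map_lt_one`,
  `norm_coeff_binomialSeries_map_pow_eq_one`).
* §4 DEGREE ONE (PROOF-BDP 60.4 (i); [GreenbergVatsal2000] «`μ(𝒫_ℓ) = 0`, `λ(𝒫_ℓ) = s_ℓ d_ℓ`»): for `u ∈ R₀`,
  `F = 1 − u·(1+T)^b`: **`FU(F, 0)` if `‖1 − u‖ = 1`** (`firstUnitCoeffAt_zero_one_sub_C_mul`); **`FU(F, p^s)` if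
  `‖1 − u‖ < 1`, `b = p^s b′`, `b′` a unit** (`firstUnitCoeffAt_pow_one_sub_C_mul`); `∃ n, FU(F, n)` for every
  `u ∈ R₀`, `b ≠ 0` (`exists_firstUnitCoeffAt_one_sub_C_mul`); the `ℤ_p`-rational readings
  `firstUnitCoeffAt_pow_one_sub_C_toUnr_mul` ∕ `…_zero_…` (`λ(1 − a_ℓ ℓ^{−k} γ_𝔩) = p^s·[a_ℓ ≡ ℓ^k (mod p)]`).

HONEST FRAMING: pure algebra of `R₀⟦T⟧`; nothing about any curve, Selmer group or `p`-adic `L`-function is asserted;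
TRANSFER's other conjuncts (analytic congruence §40, residual `μ`-transfer ∕ `λ`-equality §37.11 ∕ §58.2) untouched;
nothing booked (T7); no item closes; no new definition (FU spelled out inline as in `X1/UnrSeriesFirstUnitCoeff.lean`).
References: [Washington1997] §7.1 Prop. 7.2; [GreenbergVatsal2000] §2 Prop. 2.4; [Castella2018] §2.2, (3.1).
-/

set_option autoImplicit false
-- the problem directory `BirchSwinnertonDyer/BirchSwinnertonDyer` (single-conjunct summit) forces the duplicate segment
set_option linter.dupNamespace false

noncomputable section

open scoped Classical

open PowerSeries Literature.NumberTheory.EllipticCurves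
  Summit.BirchSwinnertonDyer.Rank1Residual.X11b.Halves
  Summit.BirchSwinnertonDyer.Rank1Residual.X1.KellerYinHalves

namespace Summit.BirchSwinnertonDyer.BirchSwinnertonDyer.Theorems.SigmaFactorFU

variable {p : ℕ} [Fact p.Prime]

/-! ### §1 The norm currency of `ℤ_p` versus reduction mod `p`; `ℤ_p → R₀` is isometric -/

/-- `‖x‖ < 1 ⟺ x ≡ 0 (mod p)` in `ℤ_p` (the maximal ideal is the kernel of `ℤ_p → 𝔽_p`). [folklore] -/
theorem norm_lt_one_iff_toZMod_eq_zero (x : ℤ_[p]) : ‖x‖ < 1 ↔ PadicInt.toZMod x = 0 := by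
  rw [← RingHom.mem_ker, PadicInt.ker_toZMod, IsLocalRing.mem_maximalIdeal, mem_nonunits_iff,
    PadicInt.isUnit_iff]
  exact ⟨fun h h1 ↦ h.ne h1, fun h ↦ lt_of_le_of_ne x.norm_le_one h⟩

/-- `‖x‖ = 1 ⟺ x ≢ 0 (mod p)` in `ℤ_p`. [folklore] -/
theorem norm_eq_one_iff_toZMod_ne_zero (x : ℤ_[p]) : ‖x‖ = 1 ↔ PadicInt.toZMod x ≠ 0 := by
  rw [Ne, ← norm_lt_one_iff_toZMod_eq_zero, not_lt]
  exact ⟨fun h ↦ h.ge, fun h ↦ le_antisymm x.norm_le_one h⟩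

/-- `‖toUnr x‖ = ‖x‖`: the structure map `ℤ_p → R₀ ⊂ ℂ_p` is isometric. [folklore] -/
theorem norm_toUnr (x : ℤ_[p]) : ‖((toUnr p x : unrIntegers p) : ℂ_[p])‖ = ‖x‖ := by
  rw [coe_toUnr, norm_algebraMap', PadicInt.norm_def]

/-- Coefficients of `map toUnr F` read in `ℂ_p` have the `ℤ_p`-norm of the coefficients of `F`. [folklore] -/
theorem norm_coeff_map_toUnr (F : PowerSeries ℤ_[p]) (i : ℕ) :
    ‖((coeff i (F.map (toUnr p)) : unrIntegers p) : ℂ_[p])‖ = ‖coeff i F‖ := by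
  rw [coeff_map, norm_toUnr]

/-! ### §2 `(1+T)^{n·r} = ((1+T)^r)^n` -/

/-- `(1 + T)^{n·r} = ((1 + T)^r)ⁿ` for the formal binomial series over a binomial ring and `n ∈ ℕ` (iterate
Mathlib's `binomialSeries_add`). [folklore] -/
theorem binomialSeries_natCast_mul {R A : Type*} [CommRing R] [BinomialRing R] [Ring A] [Algebra R A]
    (n : ℕ) (r : R) : binomialSeries A ((n : R) * r) = binomialSeries A r ^ n := by
  induction n with
  | zero => rw [Nat.cast_zero, zero_mul, binomialSeries_zero, pow_zero]
  | succ n ih => rw [Nat.cast_succ, add_mul, one_mul, binomialSeries_add, ih, pow_succ]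

/-! ### §3 `(1+T)^{p^s b′} ≡ 1 + T^{p^s}·H (mod p)`, `H(0) = b̄′^{p^s}` -/

/-- `[T^i]` of the reduction mod `p` of `(1+T)^b` is `C(b, i) mod p`. [folklore] -/
theorem coeff_map_toZMod_binomialSeries (b : ℤ_[p]) (i : ℕ) :
    coeff i ((binomialSeries ℤ_[p] b).map (PadicInt.toZMod (p := p))) =
      PadicInt.toZMod (Ring.choose b i) := by
  rw [coeff_map, binomialSeries_coeff, smul_eq_mul, mul_one]

/-- **Frobenius on `(1+T)^b` mod `p`.** For `b = p^s · b′ ∈ ℤ_p`: `(1+T)^b ≡ 1 + T^{p^s} · H (mod p)` in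
`𝔽_p⟦T⟧` with `H(0) = b̄′^{p^s}` — since `(1+T)^{p^s b′} = ((1+T)^{b′})^{p^s}` and `(1 + T·G)^{p^s} = 1 + T^{p^s} G^{p^s}`
in characteristic `p`. This is the computation behind «`λ(1 − γ_𝔩) = p^s`» of [GreenbergVatsal2000, Prop. 2.4].
[folklore] -/
theorem exists_map_toZMod_binomialSeries_eq (s : ℕ) (b' : ℤ_[p]) :
    ∃ H : PowerSeries (ZMod p), constantCoeff H = PadicInt.toZMod b' ^ p ^ s ∧
      (binomialSeries ℤ_[p] ((p : ℤ_[p]) ^ s * b')).map (PadicInt.toZMod (p := p)) =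
        1 + X ^ p ^ s * H := by
  haveI : CharP (PowerSeries (ZMod p)) p := charP_of_injective_ringHom PowerSeries.C_injective p
  set B' : PowerSeries (ZMod p) := (binomialSeries ℤ_[p] b').map (PadicInt.toZMod (p := p)) with hB'
  set G : PowerSeries (ZMod p) := PowerSeries.mk fun i ↦ coeff (i + 1) B' with hG
  have hc : constantCoeff B' = 1 := by
    rw [hB', ← coeff_zero_eq_constantCoeff_apply, coeff_map_toZMod_binomialSeries, Ring.choose_zero_right,
      map_one]
  have hsplit : B' = X * G + 1 := by
    have h := eq_X_mul_shift_add_const B'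
    rw [hc, map_one] at h
    exact h
  refine ⟨G ^ p ^ s, ?_, ?_⟩
  · rw [map_pow, ← coeff_zero_eq_constantCoeff_apply, hG, coeff_mk, zero_add, hB',
      coeff_map_toZMod_binomialSeries, Ring.choose_one_right]
  · have hnat : (p : ℤ_[p]) ^ s * b' = ((p ^ s : ℕ) : ℤ_[p]) * b' := by rw [Nat.cast_pow]
    rw [hnat, binomialSeries_natCast_mul, map_pow, ← hB', hsplit, add_pow_char_pow, one_pow, mul_pow,
      add_comm]

/-- `[T^i]` of `(1+T)^{p^s b′}` is `≡ 0 (mod p)` for `0 < i < p^s`. [folklore] -/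
theorem toZMod_choose_eq_zero_of_lt (s : ℕ) (b' : ℤ_[p]) {i : ℕ} (hi0 : 0 < i) (hi : i < p ^ s) :
    PadicInt.toZMod (Ring.choose ((p : ℤ_[p]) ^ s * b') i) = 0 := by
  obtain ⟨H, -, hH⟩ := exists_map_toZMod_binomialSeries_eq (p := p) s b'
  rw [← coeff_map_toZMod_binomialSeries, hH, map_add, coeff_one, if_neg hi0.ne', coeff_X_pow_mul',
    if_neg (not_le.mpr hi), add_zero]

/-- `[T^{p^s}]` of `(1+T)^{p^s b′}` is `≡ b̄′^{p^s} (mod p)`. [folklore] -/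
theorem toZMod_choose_pow (s : ℕ) (b' : ℤ_[p]) :
    PadicInt.toZMod (Ring.choose ((p : ℤ_[p]) ^ s * b') (p ^ s)) = PadicInt.toZMod b' ^ p ^ s := by
  obtain ⟨H, hH0, hH⟩ := exists_map_toZMod_binomialSeries_eq (p := p) s b'
  have hq : (p ^ s : ℕ) ≠ 0 := pow_ne_zero _ (Fact.out : p.Prime).ne_zero
  rw [← coeff_map_toZMod_binomialSeries, hH, map_add, coeff_one, if_neg hq, coeff_X_pow_mul', if_pos le_rfl,
    Nat.sub_self, coeff_zero_eq_constantCoeff_apply, hH0, zero_add]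

/-- In `R₀⟦T⟧`: the coefficients of `(1+T)^{p^s b′}` of index `0 < i < p^s` have norm `< 1`. [folklore] -/
theorem norm_coeff_binomialSeries_map_lt_one (s : ℕ) (b' : ℤ_[p]) {i : ℕ} (hi0 : 0 < i) (hi : i < p ^ s) :
    ‖((coeff i ((binomialSeries ℤ_[p] ((p : ℤ_[p]) ^ s * b')).map (toUnr p)) : unrIntegers p) : ℂ_[p])‖
      < 1 := by
  rw [coeff_binomialSeries_map, norm_toUnr, norm_lt_one_iff_toZMod_eq_zero]
  exact toZMod_choose_eq_zero_of_lt s b' hi0 hi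

/-- In `R₀⟦T⟧`: the coefficient of `(1+T)^{p^s b′}` at `p^s` is a unit when `b′ ∈ ℤ_p^×`. [folklore] -/
theorem norm_coeff_binomialSeries_map_pow_eq_one (s : ℕ) {b' : ℤ_[p]} (hb' : IsUnit b') :
    ‖((coeff (p ^ s) ((binomialSeries ℤ_[p] ((p : ℤ_[p]) ^ s * b')).map (toUnr p)) : unrIntegers p) :
      ℂ_[p])‖ = 1 := by
  rw [coeff_binomialSeries_map, norm_toUnr, norm_eq_one_iff_toZMod_ne_zero, toZMod_choose_pow]
  exact pow_ne_zero _ ((norm_eq_one_iff_toZMod_ne_zero b').mp (PadicInt.isUnit_iff.mp hb'))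

/-- `[T^0] (1+T)^b = 1` in `R₀⟦T⟧`. [folklore] -/
theorem coeff_zero_binomialSeries_map (b : ℤ_[p]) :
    coeff 0 ((binomialSeries ℤ_[p] b).map (toUnr p)) = 1 := by
  rw [coeff_binomialSeries_map, Ring.choose_zero_right, map_one]

/-- Every coefficient of `(1+T)^b ∈ R₀⟦T⟧` has norm `≤ 1`. [folklore] -/
theorem norm_coeff_binomialSeries_map_le_one (b : ℤ_[p]) (i : ℕ) :
    ‖((coeff i ((binomialSeries ℤ_[p] b).map (toUnr p)) : unrIntegers p) : ℂ_[p])‖ ≤ 1 :=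
  norm_coeff_le_one _ _

/-! ### §4 DEGREE ONE: `F = 1 − u·(1+T)^b`, `u ∈ R₀` (PROOF-BDP 60.4 (i)) -/

/-- The `i`-th coefficient of `1 − u·B`, read in `ℂ_p`. [folklore] -/
theorem coe_coeff_one_sub_C_mul (u : unrIntegers p) (B : UnrSeries p) (i : ℕ) :
    ((coeff i (1 - C u * B) : unrIntegers p) : ℂ_[p]) =
      (if i = 0 then 1 else 0) - (u : ℂ_[p]) * ((coeff i B : unrIntegers p) : ℂ_[p]) := by
  rw [map_sub, coeff_C_mul, coeff_one]
  push_cast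
  split_ifs <;> rfl

/-- **`λ = 0` branch.** If `‖1 − u‖ = 1` (i.e. `u ≢ 1 mod 𝔪_{R₀}`; in particular if `u` is a non-unit), then
`F = 1 − u·(1+T)^b` has a unit constant term: `FU(F, 0)` (`μ(F) = λ(F) = 0`), for every `b ∈ ℤ_p`.
[cite: GreenbergVatsal2000, Prop. 2.4 (the case `α_i ℓ⁻¹ ≢ 1`)] -/
theorem firstUnitCoeffAt_zero_one_sub_C_mul {u : unrIntegers p}
    (hu : ‖((1 : ℂ_[p]) - (u : ℂ_[p]))‖ = 1) (b : ℤ_[p]) :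
    ‖((coeff 0 (1 - C u * (binomialSeries ℤ_[p] b).map (toUnr p)) : unrIntegers p) : ℂ_[p])‖ = 1 ∧
      ∀ i < 0, ‖((coeff i (1 - C u * (binomialSeries ℤ_[p] b).map (toUnr p)) : unrIntegers p) :
        ℂ_[p])‖ < 1 := by
  refine ⟨?_, fun i hi ↦ absurd hi (Nat.not_lt_zero i)⟩
  rw [coe_coeff_one_sub_C_mul, if_pos rfl, coeff_zero_binomialSeries_map]
  push_cast
  rw [mul_one, hu]

/-- `‖1 − u‖ < 1 ⟹ ‖u‖ = 1` in `ℂ_p` (ultrametric). [folklore] -/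
theorem norm_eq_one_of_norm_one_sub_lt {u : ℂ_[p]} (hu : ‖(1 : ℂ_[p]) - u‖ < 1) : ‖u‖ = 1 := by
  have h : u = 1 + -(1 - u) := by ring
  have hne : ‖(1 : ℂ_[p])‖ ≠ ‖-(1 - u)‖ := by rw [norm_neg, norm_one]; exact hu.ne'
  rw [h, IsUltrametricDist.norm_add_eq_max_of_norm_ne_norm hne, norm_neg, norm_one, max_eq_left hu.le]

/-- **`λ = p^s` branch** (PROOF-BDP 60.4 (i); [GreenbergVatsal2000] «`λ = s_ℓ d_ℓ`»). If `‖1 − u‖ < 1`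
(`u ≡ 1 mod 𝔪_{R₀}`) and `b = p^s · b′` with `b′ ∈ ℤ_p^×`, then `F = 1 − u·(1+T)^b ∈ R₀⟦T⟧` has `μ(F) = 0` and
its first unit coefficient at `p^s`: `FU(F, p^s)`. Proof: `[T^0]F = 1 − u`, `[T^i]F = −u·C(b,i)` with `C(b,i) ≡ 0`
for `0 < i < p^s` and `C(b, p^s) ≡ b̄′ ≢ 0 (mod p)` (§3).
[cite: GreenbergVatsal2000, Prop. 2.4 (proof: «μ(𝒫_ℓ) = 0, λ(𝒫_ℓ) = s_ℓ d_ℓ»)] -/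
theorem firstUnitCoeffAt_pow_one_sub_C_mul {u : unrIntegers p}
    (hu : ‖((1 : ℂ_[p]) - (u : ℂ_[p]))‖ < 1) (s : ℕ) {b' : ℤ_[p]} (hb' : IsUnit b') :
    ‖((coeff (p ^ s) (1 - C u * (binomialSeries ℤ_[p] ((p : ℤ_[p]) ^ s * b')).map (toUnr p)) :
        unrIntegers p) : ℂ_[p])‖ = 1 ∧
      ∀ i < p ^ s, ‖((coeff i (1 - C u * (binomialSeries ℤ_[p] ((p : ℤ_[p]) ^ s * b')).map (toUnr p)) :
        unrIntegers p) : ℂ_[p])‖ < 1 := by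
  have hq : (p ^ s : ℕ) ≠ 0 := pow_ne_zero _ (Fact.out : p.Prime).ne_zero
  have hu1 : ‖(u : ℂ_[p])‖ = 1 := norm_eq_one_of_norm_one_sub_lt hu
  refine ⟨?_, fun i hi ↦ ?_⟩
  · rw [coe_coeff_one_sub_C_mul, if_neg hq, zero_sub, norm_neg, norm_mul, hu1, one_mul]
    exact norm_coeff_binomialSeries_map_pow_eq_one s hb'
  · rcases Nat.eq_zero_or_pos i with rfl | hi0
    · rw [coe_coeff_one_sub_C_mul, if_pos rfl, coeff_zero_binomialSeries_map]
      push_cast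
      rwa [mul_one]
    · rw [coe_coeff_one_sub_C_mul, if_neg hi0.ne', zero_sub, norm_neg, norm_mul, hu1, one_mul]
      exact norm_coeff_binomialSeries_map_lt_one s b' hi0 hi

/-- `b ≠ 0` in `ℤ_p` is `p^{v(b)} · b′` with `b′` a unit (Mathlib's `PadicInt.unitCoeff`). [folklore] -/
theorem exists_eq_pow_mul_unit {b : ℤ_[p]} (hb : b ≠ 0) :
    ∃ (s : ℕ) (b' : ℤ_[p]), IsUnit b' ∧ b = (p : ℤ_[p]) ^ s * b' :=
  ⟨b.valuation, (PadicInt.unitCoeff hb : ℤ_[p]), (PadicInt.unitCoeff hb).isUnit,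
    by rw [mul_comm]; exact PadicInt.unitCoeff_spec hb⟩

/-- **`μ(1 − u·γ_𝔩) = 0` for every `u ∈ R₀` and every `b ∈ ℤ_p ∖ {0}`**: the degree-one Σ-factor
`F = 1 − u·(1+T)^b` has a first unit coefficient (at `0` if `u ≢ 1`, at `p^{v_p(b)}` if `u ≡ 1 mod 𝔪_{R₀}`).
This is the `FU(P, m)` conjunct of TRANSFER for one local factor of `E` at `ℓ ∥ N` (`u = a_ℓ ℓ⁻¹`).
[cite: GreenbergVatsal2000, Prop. 2.4] -/
theorem exists_firstUnitCoeffAt_one_sub_C_mul (u : unrIntegers p) {b : ℤ_[p]} (hb : b ≠ 0) :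
    ∃ n : ℕ, ‖((coeff n (1 - C u * (binomialSeries ℤ_[p] b).map (toUnr p)) : unrIntegers p) : ℂ_[p])‖ = 1 ∧
      ∀ i < n, ‖((coeff i (1 - C u * (binomialSeries ℤ_[p] b).map (toUnr p)) : unrIntegers p) :
        ℂ_[p])‖ < 1 := by
  have hle : ‖((1 : ℂ_[p]) - (u : ℂ_[p]))‖ ≤ 1 := by
    have h := norm_coe_unrIntegers_le_one p (1 - u)
    push_cast at h
    exact h
  rcases hle.lt_or_eq with hlt | heq
  · obtain ⟨s, b', hb', rfl⟩ := exists_eq_pow_mul_unit hb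
    exact ⟨p ^ s, firstUnitCoeffAt_pow_one_sub_C_mul hlt s hb'⟩
  · exact ⟨0, firstUnitCoeffAt_zero_one_sub_C_mul heq b⟩

/-- **λ-table, degree one, `ℤ_p`-rational unit** (PROOF-BDP 60.4 (ii)∕(v)): for `u ∈ ℤ_p` with `u ≡ 1 (mod p)` and
`b = p^s b′`, `b′ ∈ ℤ_p^×`: `FU(1 − u·(1+T)^b, p^s)`. With `u = a_ℓ ℓ^{−k}` this reads `λ = p^s·[a_ℓ ≡ ℓ^k (mod p)]`.
[cite: GreenbergVatsal2000, Prop. 2.4] -/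
theorem firstUnitCoeffAt_pow_one_sub_C_toUnr_mul {u : ℤ_[p]} (hu : PadicInt.toZMod (1 - u) = 0) (s : ℕ)
    {b' : ℤ_[p]} (hb' : IsUnit b') :
    ‖((coeff (p ^ s) (1 - C (toUnr p u) * (binomialSeries ℤ_[p] ((p : ℤ_[p]) ^ s * b')).map (toUnr p)) :
        unrIntegers p) : ℂ_[p])‖ = 1 ∧
      ∀ i < p ^ s, ‖((coeff i (1 - C (toUnr p u) *
        (binomialSeries ℤ_[p] ((p : ℤ_[p]) ^ s * b')).map (toUnr p)) : unrIntegers p) : ℂ_[p])‖ < 1 := by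
  refine firstUnitCoeffAt_pow_one_sub_C_mul ?_ s hb'
  have h := (norm_lt_one_iff_toZMod_eq_zero (1 - u)).mpr hu
  rw [← norm_toUnr, map_sub, map_one] at h
  push_cast at h
  exact h

/-- **λ-table, degree one, `ℤ_p`-rational non-congruent coefficient**: for `u ∈ ℤ_p` with `u ≢ 1 (mod p)` and any
`b`: `FU(1 − u·(1+T)^b, 0)`. [cite: GreenbergVatsal2000, Prop. 2.4] -/
theorem firstUnitCoeffAt_zero_one_sub_C_toUnr_mul {u : ℤ_[p]} (hu : PadicInt.toZMod (1 - u) ≠ 0) (b : ℤ_[p]) :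
    ‖((coeff 0 (1 - C (toUnr p u) * (binomialSeries ℤ_[p] b).map (toUnr p)) : unrIntegers p) : ℂ_[p])‖ = 1 ∧
      ∀ i < 0, ‖((coeff i (1 - C (toUnr p u) * (binomialSeries ℤ_[p] b).map (toUnr p)) : unrIntegers p) :
        ℂ_[p])‖ < 1 := by
  refine firstUnitCoeffAt_zero_one_sub_C_mul ?_ b
  have h := (norm_eq_one_iff_toZMod_ne_zero (1 - u)).mpr hu
  rw [← norm_toUnr, map_sub, map_one] at h
  push_cast at h
  exact h

end Summit.BirchSwinnertonDyer.BirchSwinnertonDyer.Theorems.SigmaFactorFU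

end
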